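import Summits.CriticalPhenomena.PercolationContinuityZ3.Theorems.Transplant.FKConnectivityAllQAntipodalTwoSpineBase
import HarnessLib

/-!
# Two-spine word model of `U¹¹` — a KERNEL-CHEAP certificate format: resolutions with explicit order paths and counted covers

Theorem file (`--supports stmt-CriticalPhenomena-4575`), FK sub-lane `prim-bschramm-fk-2` (gen 15); builds on p205010 (kernel
theorem, internal audit signed; external expert review pending).  No named facts, no sorries.

The closure certificates of the mode induction (memo g15 §6) are checked by `decide`, i.e. evaluated by the kernel.  This file gives
a variant of `…TwoSpineResolve` / `…TwoSpineInduction` whose check is cheap to evaluate: (i) the cover condition is verified by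
COUNTING (`every node index below the length occurs exactly once in the concatenated node maps, and nothing else occurs`) instead of
deciding `List.Perm`; (ii) every order constraint of a piece carries an explicit PATH of constraints of the resolved diagram instead
of a reachability closure.  `FK.TwoSpine.PathPiece`, `Resolution.checkP`, **`DStmt.of_resolutionP`**; `FK.TwoSpine.PCert`,
`PCert.check`, **`PCert.sound`**, **`PCert.sound_of_baseAll`** (with the base certificates of `…TwoSpineBase`).
[cite: Grimmett2006, §3.8 (pp. 61–62)]
-/

noncomputable section

namespace Summit.CriticalPhenomena.PercolationContinuityZ3.Theorems

namespace FK

namespace TwoSpine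

open X2Word

/-! ### Paths along the order constraints -/

/-- `isPath le x path y`: consecutive pairs of `x :: path` ending at `y` are constraints of `le`. [folklore] -/
def isPath (le : List (ℕ × ℕ)) : ℕ → List ℕ → ℕ → Bool
  | x, [], y => decide (x = y)
  | x, z :: path, y => decide ((x, z) ∈ le) && isPath le z path y

/-- An admissible family is monotone along a path of constraints. [folklore] -/
theorem Admissible.le_of_isPath {D : Diagram} {S : ℕ → List SLetter → List SLetter → ℝ} (hS : Admissible D S)
    (path : List ℕ) : ∀ x y : ℕ, isPath D.le x path y = true → ∀ u v, S x u v ≤ S y u v := by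
  induction path with
  | nil => intro x y h u v; simp only [isPath, decide_eq_true_eq] at h; rw [h]
  | cons z path ih =>
    intro x y h u v
    simp only [isPath, Bool.and_eq_true, decide_eq_true_eq] at h
    exact (hS.le (x, z) h.1 u v).trans (ih z y h.2 u v)

/-! ### Pieces with paths; the cheap resolution check -/

/-- A piece of a resolution with explicit paths: sub-diagram (by family index), node map, exponent offset, and one path per
order constraint of the sub-diagram (intermediate nodes of the resolved diagram). [folklore] -/
structure PathPiece where
  /-- index of the sub-diagram in the family -/
  idx : ℕ
  /-- node `a` of the sub-diagram is node `f[a]` of the resolved diagram -/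
  f : List ℕ
  /-- exponent offset -/
  c : ℕ
  /-- `paths[t]` = intermediate nodes justifying constraint `t` of the sub-diagram -/
  paths : List (List ℕ)

/-- The underlying `Piece` against a family. [folklore] -/
def PathPiece.toPiece (fam : List Diagram) (pp : PathPiece) : Piece := ⟨fam.getD pp.idx dfltDiagram, pp.f, pp.c⟩

/-- **Cheap resolution CHECK**: counted exact cover, label/offset match, and path-justified order constraints. [folklore] -/
def Resolution.checkP (fam : List Diagram) (D : Diagram) (pieces : List PathPiece) : Bool :=
  let flat := pieces.flatMap fun pp => pp.f
  decide (flat.length = D.nodes.length) &&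
  flat.all (fun n => decide (n < D.nodes.length)) &&
  (List.range D.nodes.length).all (fun n => decide (flat.count n = 1)) &&
  pieces.all fun pp =>
    let P := fam.getD pp.idx dfltDiagram
    decide (pp.idx < fam.length) &&
    decide (pp.f.length = P.nodes.length) &&
    (List.range P.nodes.length).all (fun a =>
      decide (D.nodes.getD (pp.f.getD a 0) dfltNode = ((P.nodes.getD a dfltNode).1, (P.nodes.getD a dfltNode).2 + pp.c))) &&
    (List.range P.le.length).all fun t =>
      isPath D.le (pp.f.getD (P.le.getD t (0, 0)).1 0) (pp.paths.getD t []) (pp.f.getD (P.le.getD t (0, 0)).2 0)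

/-- Counted exact cover ⇒ the concatenated node maps are a permutation of `range`. [folklore] -/
theorem perm_range_of_count {flat : List ℕ} {L : ℕ} (hlt : ∀ n ∈ flat, n < L)
    (hcount : ∀ n < L, flat.count n = 1) : flat.Perm (List.range L) := by
  rw [List.perm_iff_count]
  intro a
  by_cases ha : a < L
  · rw [hcount a ha, List.count_eq_one_of_mem List.nodup_range (List.mem_range.2 ha)]
  · rw [List.count_eq_zero_of_not_mem (fun h => ha (hlt a h)), List.count_eq_zero_of_not_mem (fun h => ha (List.mem_range.1 h))]

/-- **RESOLUTION SOUNDNESS** for the cheap check. [folklore] -/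
theorem DStmt.of_resolutionP {q : ℝ} (hq : 0 ≤ q) {top : Top} {fam : List Diagram} {D : Diagram} {pieces : List PathPiece}
    (hc : Resolution.checkP fam D pieces = true) {oA oB : List Kind}
    (hP : ∀ pp ∈ pieces, DStmt q top (fam.getD pp.idx dfltDiagram) oA oB) : DStmt q top D oA oB := by
  intro S hS
  unfold Resolution.checkP at hc
  simp only [Bool.and_eq_true, decide_eq_true_eq, List.all_eq_true, List.mem_range] at hc
  obtain ⟨⟨⟨-, hlt⟩, hcount⟩, hpc⟩ := hc
  have hperm := perm_range_of_count (fun n hn => hlt n hn) hcount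
  rw [dsum_eq_list_sum, ← (hperm.map (nodeTerm q top D oA oB S)).sum_eq, List.map_flatMap, List.flatMap_def, List.sum_flatten,
    List.map_map]
  refine List.sum_nonneg (fun x hx => ?_)
  rw [List.mem_map] at hx
  obtain ⟨pp, hpp, rfl⟩ := hx
  obtain ⟨⟨⟨-, hlen'⟩, hlab⟩, hle⟩ := hpc pp hpp
  show 0 ≤ (pp.f.map (nodeTerm q top D oA oB S)).sum
  rw [show pp.f = (pp.toPiece fam).f from rfl, dsum_piece q top D oA oB S (pp.toPiece fam) hlen' hlab]
  refine mul_nonneg (pow_nonneg hq _) (hP pp hpp _ ?_)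
  -- admissibility of the restricted family, constraints justified by paths
  exact
    { nonneg := fun _ _ _ => hS.nonneg _ _ _
      monoA := fun _ _ _ _ h => hS.monoA _ _ _ _ h
      monoB := fun _ _ _ _ h => hS.monoB _ _ _ _ h
      le := fun ab hab u v => by
        obtain ⟨t, ht, rfl⟩ := (mem_iff_getD _ (0, 0) ab).1 hab
        exact hS.le_of_isPath _ _ _ (hle t ht) u v }

/-! ### Certificates with paths -/

/-- A closure certificate in the cheap format. [folklore] -/
structure PCert where
  /-- the family -/
  family : List Diagram
  /-- `resA[d][0/1]` resolves `(family[d]).peelA W/P` -/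
  resA : List (List (List PathPiece))
  /-- `resB[d][0/1]` resolves `(family[d]).peelB W/P` -/
  resB : List (List (List PathPiece))

/-- Position of an op kind in the resolution tables. [folklore] -/
def kindIdx : Kind → ℕ
  | .W => 0
  | .P => 1

/-- The resolution of `family[d]` peeled on side `A` by kind `k`. [folklore] -/
def PCert.getA (C : PCert) (d : ℕ) (k : Kind) : List PathPiece := (C.resA.getD d []).getD (kindIdx k) []
/-- The resolution of `family[d]` peeled on side `B` by kind `k`. [folklore] -/
def PCert.getB (C : PCert) (d : ℕ) (k : Kind) : List PathPiece := (C.resB.getD d []).getD (kindIdx k) []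

/-- The decidable CHECK of a cheap closure certificate. [folklore] -/
def PCert.check (C : PCert) : Bool :=
  (List.range C.family.length).all fun d =>
    [Kind.W, Kind.P].all fun k =>
      Resolution.checkP C.family ((C.family.getD d dfltDiagram).peelA k) (C.getA d k) &&
      Resolution.checkP C.family ((C.family.getD d dfltDiagram).peelB k) (C.getB d k)

/-- **SOUNDNESS**: a checked cheap certificate plus the base cases proves every member for every pair of shapes. [folklore] -/
theorem PCert.sound {q : ℝ} (hq : 0 ≤ q) (top : Top) (C : PCert) (hc : C.check = true)
    (hbase : ∀ D ∈ C.family, DStmt q top D [] []) : ∀ D ∈ C.family, ∀ oA oB : List Kind, DStmt q top D oA oB := by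
  have hcheck : ∀ d < C.family.length, ∀ k : Kind,
      Resolution.checkP C.family ((C.family.getD d dfltDiagram).peelA k) (C.getA d k) = true ∧
      Resolution.checkP C.family ((C.family.getD d dfltDiagram).peelB k) (C.getB d k) = true := by
    intro d hd k
    unfold PCert.check at hc
    simp only [List.all_eq_true, List.mem_range, Bool.and_eq_true] at hc
    have hk : k ∈ [Kind.W, Kind.P] := by cases k <;> simp
    exact hc d hd k hk
  have hmem : ∀ pp : PathPiece, pp.idx < C.family.length → C.family.getD pp.idx dfltDiagram ∈ C.family :=
    fun pp h => (mem_iff_getD C.family dfltDiagram _).2 ⟨pp.idx, h, rfl⟩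
  have hidx : ∀ {E : Diagram} {pieces : List PathPiece}, Resolution.checkP C.family E pieces = true →
      ∀ pp ∈ pieces, pp.idx < C.family.length := by
    intro E pieces h pp hpp
    unfold Resolution.checkP at h
    simp only [Bool.and_eq_true, decide_eq_true_eq, List.all_eq_true] at h
    exact (h.2 pp hpp).1.1.1
  have hB : ∀ oB : List Kind, ∀ D ∈ C.family, DStmt q top D [] oB := by
    intro oB
    induction oB using List.reverseRecOn with
    | nil => exact hbase
    | append_singleton oB k ih =>
      intro D hD
      obtain ⟨d, hd, rfl⟩ := (mem_iff_getD C.family dfltDiagram D).1 hD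
      have hres := (hcheck d hd k).2
      exact DStmt.of_peelB (DStmt.of_resolutionP hq hres fun pp hpp => ih _ (hmem pp (hidx hres pp hpp)))
  intro D hD oA
  induction oA using List.reverseRecOn generalizing D with
  | nil => exact fun oB => hB oB D hD
  | append_singleton oA k ih =>
    intro oB
    obtain ⟨d, hd, rfl⟩ := (mem_iff_getD C.family dfltDiagram D).1 hD
    have hres := (hcheck d hd k).1
    exact DStmt.of_peelA (DStmt.of_resolutionP hq hres fun pp hpp => ih _ (hmem pp (hidx hres pp hpp)) oB)

/-- **THE MODE INDUCTION, cheap format**: checked closure + checked base certificates ⇒ every member, all shapes, `0 ≤ q ≤ 1`. [folklore] -/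
theorem PCert.sound_of_baseAll {q : ℝ} (hq0 : 0 ≤ q) (hq1 : q ≤ 1) (top : Top) (C : PCert) (hc : C.check = true)
    {bcs : List BaseCert} (hb : baseAll top C.family bcs = true) :
    ∀ D ∈ C.family, ∀ oA oB : List Kind, DStmt q top D oA oB :=
  PCert.sound hq0 top C hc (DStmt.nil_nil_of_baseAll hq0 hq1 hb)

end TwoSpine

end FK

end Summit.CriticalPhenomena.PercolationContinuityZ3.Theorems

end
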